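import Summits.Langlands.Langlands.Theses.RamifiedCoefficientSeed
import Literature.NumberTheory.GaloisRepresentations.AbsIrreducibleIndexTwo
import Literature.NumberTheory.Automorphic.BCDTModularity

/-!
# `RamifiedCoefficientSeed.SectorComplement` (stmt-Langlands-16781) — logical position (SUSPECT-EQUIVALENCE audit)

Crux-strategist unit `cstrat-stmt-Langlands-16781-q1` (2026-08-17). The payload witness
`Theorems.skinnerWilesDefectOne_sectorComplement_iff_of_target` concerns the HOMONYMOUS frame item of route
SkinnerWilesDefectOne (`ReducibleOrdinaryModular → Langlands`, stmt-Langlands-12923), a different statement;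
this file records the identical position for THIS route's frame
`SectorComplement : Prop := NonPolarisableFamilyAutomorphic → _root_.Langlands`, kernel-checked, together with
the two facts special to this route:

* `rcs_sectorComplement_of_langlands`: `Langlands → SectorComplement`;
* `rcs_sectorComplement_iff_of_target`: under the route target `NonPolarisableFamilyAutomorphic` (=: X),
  `SectorComplement ↔ Langlands` (the suspect equivalence, verbatim);
* `rcs_target_of_cruxes`: X from the three ranked cruxes `ExplicitRamifiedFamily`, `AdjointSeedFromDuality`,
  `AdjointLiftingGL3` (the inner logic of the route's deciding theorem `closes`, restated);
* `rcs_sectorComplement_iff_of_cruxes`: under the three ranked cruxes, `SectorComplement ↔ Langlands`;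
* `rcs_not_sectorComplement_iff`: `¬ SectorComplement ↔ X ∧ ¬ Langlands`;
* `rcs_sectorComplement_iff_not_or`: truth table;
* SPECIAL (i) `rcs_adjointLiftingGL3_of_langlands`: `Langlands → AdjointLiftingGL3` — the engine crux (rank 3) is a
  CONSEQUENCE of the summit (direction (B) at `n = 3`, `F = ℚ`; its seed / weight / `11 ≤ p` hypotheses unused), i.e.
  a weakest-unknown-consequence-type crux used toward X (re-derivation of the refuter's `SofC.lean` on stmt-16779);
* SPECIAL (ii) `rcs_target_of_family_of_langlands`: `ExplicitRamifiedFamily → Langlands → X`, and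
  `rcs_langlands_iff_target_and_sectorComplement_of_family`: `ExplicitRamifiedFamily → (Langlands ↔ X ∧ SectorComplement)`
  — modulo the summit, the target X is exactly the EXISTENCE content of the explicit-family crux (rank 2);
  `Langlands → X` alone is not formal (X asserts that an infinite twist-inequivalent non-self-dual family of rank-3
  representations EXISTS), so the unconditional bookkeeping identity `Langlands ↔ X ∧ SectorComplement` is
  deliberately absent (contrast SenNullAlignment, where it holds by pure logic). Both go through
  `rcs_weakB_rank3_of_langlands` (direction (B), `n = 3`, `F = ℚ`, weak form, for every `𝓡`).

Verdict of the audit (EQUIVALENCE-AUDIT_RamifiedCoefficientSeed.md): equivalence-benign — no item of the route is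
proved; the binders the equivalence is conditional on are open, refuter-vetted and probe-clean; the frame is the
honest rest of the summit ("OUT-OF-SCOPE REMAINDER", rank 5, never staffed from this route).
-/

set_option linter.dupNamespace false

namespace Summit.Langlands.Langlands.Cruxes.SectorComplement.EquivalenceAuditRCS

open Summit.Langlands.Langlands.Theses.RamifiedCoefficientSeed
open Literature.NumberTheory.GaloisRepresentations

/-- The frame is implied by the summit (discard the sector hypothesis). [folklore] -/
theorem rcs_sectorComplement_of_langlands : _root_.Langlands → SectorComplement :=
  fun h _ ↦ h

/-- Under the route target X = `NonPolarisableFamilyAutomorphic` the frame IS the summit. [folklore] -/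
theorem rcs_sectorComplement_iff_of_target (hX : NonPolarisableFamilyAutomorphic) :
    SectorComplement ↔ _root_.Langlands :=
  ⟨fun hC ↦ hC hX, fun h _ ↦ h⟩

/-- The target from the three ranked cruxes — the inner logic of `closes`, restated: the explicit family
supplies `p ≥ 11` and `f`; member-wise, residual duality + irreducibility + trace-`±1` conjugation give the odd
adjoint seed (`AdjointSeedFromDuality`, `5 ≤ 11 ≤ p`), and the engine `AdjointLiftingGL3` returns the cuspidal
`π` with Satake matching a.e. Every hypothesis is used. [folklore] -/
theorem rcs_target_of_cruxes (h1 : ExplicitRamifiedFamily) (h2 : AdjointSeedFromDuality)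
    (h3 : AdjointLiftingGL3) : NonPolarisableFamilyAutomorphic := by
  obtain ⟨p, hp, h11, f, hne, hf⟩ := h1
  refine ⟨p, hp, h11, f, hne, fun n => (hf n).1, fun n ι hcpt => ?_⟩
  obtain ⟨_hnsd, hunr, hcrys, hdual, hirr, hcc⟩ := hf n
  exact h3 p h11 (f n) hunr hcrys hirr (h2 p (le_trans (by norm_num) h11) (f n) hdual hirr hcc) ι hcpt

/-- Under the three ranked cruxes the frame is the summit (`→` is the route's sorry-free `closes`). [folklore] -/
theorem rcs_sectorComplement_iff_of_cruxes (h1 : ExplicitRamifiedFamily) (h2 : AdjointSeedFromDuality)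
    (h3 : AdjointLiftingGL3) : SectorComplement ↔ _root_.Langlands :=
  rcs_sectorComplement_iff_of_target (rcs_target_of_cruxes h1 h2 h3)

/-- The same, through the route's own deciding theorem. [folklore] -/
theorem rcs_sectorComplement_iff_of_cruxes' (h1 : ExplicitRamifiedFamily) (h2 : AdjointSeedFromDuality)
    (h3 : AdjointLiftingGL3) : SectorComplement ↔ _root_.Langlands :=
  ⟨fun hC ↦ closes h1 h2 h3 hC, fun h _ ↦ h⟩

/-- Exact content of a refutation of the frame: PROVE the sector target AND disprove the formal summit.
[folklore] -/
theorem rcs_not_sectorComplement_iff :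
    ¬ SectorComplement ↔ NonPolarisableFamilyAutomorphic ∧ ¬ _root_.Langlands :=
  Classical.not_imp

/-- Any refutation of the frame is a disproof of the formal summit. [folklore] -/
theorem rcs_not_langlands_of_not_sectorComplement : ¬ SectorComplement → ¬ _root_.Langlands :=
  fun h ↦ (rcs_not_sectorComplement_iff.1 h).2

/-- Truth table of the frame. [folklore] -/
theorem rcs_sectorComplement_iff_not_or :
    SectorComplement ↔ ¬ NonPolarisableFamilyAutomorphic ∨ _root_.Langlands :=
  imp_iff_not_or

/-- Direction (B) of the summit at `n = 3`, `F = ℚ`, in the WEAK (a.e.-Satake) form, for a `ρ` that is unramified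
a.e., de Rham above `p` for Fontaine's pinned datum, and residually absolutely irreducible over `ℚ(ζ_p)`: for ANY
reciprocity data `𝓡` (one exists by the `Nonempty` conjunct) `ρ` is irreducible (residual absolute irreducibility
⇒ absolute irreducibility of `ρ|ℚ(ζ_p)` ⇒ of `ρ` ⇒ irreducibility) and `𝓡`-geometric (`𝓡.pst p v hv` is BY
DEFINITION `fontainePstAdicCompletion v p hv`), and the Satake clause of `Corresponds` is the conclusion. [folklore] -/
theorem rcs_weakB_rank3_of_langlands (hL : _root_.Langlands) (p : ℕ) [Fact p.Prime]
    (ρ : FramedGaloisRep ℚ (PadicAlgCl p) 3)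
    (hunr : ∀ᶠ v : IsDedekindDomain.HeightOneSpectrum (NumberField.RingOfIntegers ℚ) in Filter.cofinite,
      ρ.IsUnramifiedAt v)
    (hdR : ∀ (v : IsDedekindDomain.HeightOneSpectrum (NumberField.RingOfIntegers ℚ))
      (hv : ((p : ℕ) : NumberField.RingOfIntegers ℚ) ∈ v.asIdeal),
      (Literature.NumberTheory.PAdicHodge.fontainePstAdicCompletion v p hv).IsDeRhamFramed (ρ.toLocal v))
    (hirr : (ρ.restrictField (CyclotomicField p ℚ)).IsResiduallyAbsIrreducible)
    (ι : PadicAlgCl p ≃+* ℂ) (hcpt : Literature.NumberTheory.Automorphic.isCompact_glFiniteIntegralLevel 3 ℚ) :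
    ∃ π : Literature.NumberTheory.Automorphic.CuspidalAutomorphicRepData 3 ℚ hcpt, π.1.IsLAlgebraic ∧
      ∀ᶠ v : IsDedekindDomain.HeightOneSpectrum (NumberField.RingOfIntegers ℚ) in Filter.cofinite,
        Summit.Langlands.SatakeFrobCompatibleAt ι π.1 ρ v := by
  obtain ⟨⟨𝓡⟩, hGL⟩ := hL ℚ
  have hB := (hGL 𝓡 3 (by norm_num) hcpt).2
  have habs : FramedRep.IsAbsolutelyIrreducible ρ :=
    FramedGaloisRep.IsAbsolutelyIrreducible.of_restrictField (CyclotomicField p ℚ) ρ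
      (FramedGaloisRep.IsResiduallyAbsIrreducible.isAbsolutelyIrreducible three_pos hirr)
  have hirr' : ρ.toGaloisRep.IsIrreducible :=
    (FramedRep.isIrreducible_toContinuousRep_iff ρ).2 habs.isIrreducible
  have hgeom : Summit.Langlands.IsGeometricFramed 𝓡 ρ := ⟨hunr, fun v hv => hdR v hv⟩
  obtain ⟨π, hLalg, hcorr⟩ := hB p ι ρ hirr' hgeom
  exact ⟨π, hLalg, hcorr.1⟩

/-- SPECIAL (i): the engine crux `AdjointLiftingGL3` is a consequence of the summit (crystalline ⇒ de Rham; the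
odd adjoint seed, the labelled weights `{0,1,2}` and `11 ≤ p` are not used). Re-derivation of the refuter's
`SofC.lean` on stmt-Langlands-16779. [folklore] -/
theorem rcs_adjointLiftingGL3_of_langlands (hL : _root_.Langlands) : AdjointLiftingGL3 := by
  intro p _ _h11 ρ hunr hcrys hirr _hseed ι hcpt
  exact rcs_weakB_rank3_of_langlands hL p ρ hunr (fun v hv => (hcrys v hv).1.isDeRhamFramed) hirr ι hcpt

/-- SPECIAL (ii): modulo the summit, the target is the existence content of the explicit-family crux — from
`ExplicitRamifiedFamily` (which supplies `p`, `f`, twist-inequivalence, non-self-duality and, member-wise,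
a.e.-unramified + crystalline + residually absolutely irreducible; its residual-duality and conjugation clauses are
not used) and `Langlands` one gets X. `Langlands → X` without the family is not formal. [folklore] -/
theorem rcs_target_of_family_of_langlands (h1 : ExplicitRamifiedFamily) (hL : _root_.Langlands) :
    NonPolarisableFamilyAutomorphic := by
  obtain ⟨p, hp, h11, f, hne, hf⟩ := h1
  refine ⟨p, hp, h11, f, hne, fun n => (hf n).1, fun n ι hcpt => ?_⟩
  obtain ⟨_hnsd, hunr, hcrys, _hdual, hirr, _hcc⟩ := hf n
  exact rcs_weakB_rank3_of_langlands hL p (f n) hunr (fun v hv => (hcrys v hv).1.isDeRhamFramed) hirr ι hcpt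

/-- Hence, GIVEN the explicit family alone, target and summit-with-frame coincide:
`ExplicitRamifiedFamily → (Langlands ↔ NonPolarisableFamilyAutomorphic ∧ SectorComplement)`. [folklore] -/
theorem rcs_langlands_iff_target_and_sectorComplement_of_family (h1 : ExplicitRamifiedFamily) :
    _root_.Langlands ↔ NonPolarisableFamilyAutomorphic ∧ SectorComplement :=
  ⟨fun hL ↦ ⟨rcs_target_of_family_of_langlands h1 hL, fun _ ↦ hL⟩, fun h ↦ h.2 h.1⟩

end Summit.Langlands.Langlands.Cruxes.SectorComplement.EquivalenceAuditRCS
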